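import Literature.NumberTheory.EllipticCurves.AnticyclotomicBigGaloisRep
import HarnessLib

/-!
# Shapiro's map for the co-induced module `M = A ⊗ Λ^*(Ψ⁻¹)` intertwines `1 + T` on `H¹(G, M)` with
# the conjugation `conj_γ̃` on `H¹(ker κ, A)` (`κ γ̃ = 1`) — the ORIENTATION lemma, cocycle level — PROVED

Topic `Literature/NumberTheory/EllipticCurves`. Theorems only: no definition, no named fact, no
`sorry`, no instance, no notation. Cell `bsd-stepL`, seat `bsd-stepL-imc-p1` (g11): module M4 (core)
of the tree-mapped discharge plan `NOTE-prop323-Shapiro-discharge-plan-imc-p1-g11` for the named fact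
`SkinnerUrban2014.prop323_XAc_equiv_XBigDecomp` ([SU14] Prop. 3.2.3, Shapiro for Selmer groups), whose
docstring records the orientation question this file settles at cocycle level ("ORIENTATION (why no
involution `ι` intervenes): Shapiro's map is `Sh[c](h) = c(h)(0)`; for `κ γ̃ = 1` the cocycle
`g ↦ γ̃·c(γ̃⁻¹ g γ̃)` is cohomologous to `c`, and evaluating it gives `Sh[(1+T)·c] = conj_γ̃ (Sh[c])`:
`1 + T` on the right matches `conj_γ` on the left").

## What is proved (generic `G`, `κ : G →ₜ* ℤ_p`, `ρ` on `A`, co-induced model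
## `(g·Φ)(x) = ρ(g)Φ(x − κ g)`, `(T·Φ)(x) = Φ(x+1) − Φ(x)`; `c` any 1-cocycle of `bigRep κ ρ`)

* `X_smul_apply_zero`, `one_add_X_smul_apply_zero` — `Sh(T·c)(h) = c(h)(1) − c(h)(0)` and
  `Sh((1+T)·c)(h) = c(h)(1)` (translation by `1 = κ γ̃`).
* **`conj_apply_zero_eq`** — for `κ γ̃ = 1` and `h ∈ ker κ`:
  `ρ(γ̃)·c(γ̃⁻¹ h γ̃)(0) = c(h)(1) + (ρ(h) b − b)` with `b = c(γ̃)(1)`; i.e. the conjugate cocycle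
  `conj_γ̃ (Sh c)` equals `Sh((1+T)·c)` PLUS THE COBOUNDARY OF `b` — the cocycle identity
  `c(γ̃) + γ̃·c(γ̃⁻¹ h γ̃) = c(h γ̃) = c(h) + h·c(γ̃)` read at `x = 1`.
* `conj_apply_zero_eq_one_add_X_smul` — the same with the left `Λ`-action spelled `((1 + T)·c(h))(0)`.
Consequently, once Shapiro's bijection `H¹(G, M) ≅ H¹(ker κ, A)` is in place (M1/M2 of the plan:
`BigRepModuleShapiroInjectiveProofs`, `BigRepModuleShapiroSurjectiveProofs`), it is `Λ`-semilinear for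
`1 + T ↦ conj_γ̃`, which is exactly the `Λ`-structure `IwasawaDual.IsLocNil.module` puts on the dual of
`Sel(K_∞)` (`T ↦ conj_γ − 1`, `AnticyclotomicSelmerDual.XAc.X_smul_apply`) — no involution.

HONEST FRAMING: a cocycle identity; nothing about elliptic curves, Selmer groups or BSD; the named fact
`prop323_…` is NOT discharged by this file.

References: [SkinnerUrban2014] §3.2.1–3.2.2 and Prop. 3.2.3 (`ε_F : G_F ↠ Γ_F ⊂ Λ^×`, the
`Λ`-structure on both sides); [Castella2018] §2.2 ("`1 + T ↦ γ`"); [GreenbergLNM1716] §1, §4 (the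
`Γ`-action on `H¹(K_∞, ·)` by conjugation). Tree: `AnticyclotomicBigGaloisRep.lean` (`bigRep_apply_apply`,
`X_smul_apply`).
-/

noncomputable section

open Multiplicative
open Literature.NumberTheory.GaloisRepresentations

namespace Literature.NumberTheory.EllipticCurves.BigRepModule

variable {𝒪 : Type*} [CommRing 𝒪] {p : ℕ} [Fact p.Prime] {A : Type*} [AddCommGroup A] [Module 𝒪 A]
  [TopologicalSpace 𝒪] [TopologicalSpace A] [DiscreteTopology A]
  {G : Type*} [Group G] [TopologicalSpace G] [ContinuousMul G] [TopologicalSpace (PowerSeries 𝒪)]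
  {κ : G →ₜ* Multiplicative ℤ_[p]} {ρ : ContinuousRep G 𝒪 A}

omit [TopologicalSpace 𝒪] [TopologicalSpace A] [DiscreteTopology A] [Group G] [TopologicalSpace G]
  [ContinuousMul G] [TopologicalSpace (PowerSeries 𝒪)] in
/-- `Sh(T·c)(h) = c(h)(1) − c(h)(0)`: `T` acts on `M` by `(T·Φ)(x) = Φ(x+1) − Φ(x)`.
[cite: Castella2018, §2.2 (ℤ_p⟦T⟧ = Λ via 1 + T ↦ γ)] -/
theorem X_smul_apply_zero (Φ : BigRepModule 𝒪 p A) :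
    ((PowerSeries.X : PowerSeries 𝒪) • Φ) 0 = Φ 1 - Φ 0 := by
  rw [X_smul_apply, zero_add]

omit [TopologicalSpace 𝒪] [TopologicalSpace A] [DiscreteTopology A] [Group G] [TopologicalSpace G]
  [ContinuousMul G] [TopologicalSpace (PowerSeries 𝒪)] in
/-- `Sh((1+T)·c)(h) = c(h)(1)`: `1 + T` acts on `M` as the translation by `1 = κ γ̃`.
[cite: Castella2018, §2.2 (ℤ_p⟦T⟧ = Λ via 1 + T ↦ γ)] -/
theorem one_add_X_smul_apply_zero (Φ : BigRepModule 𝒪 p A) :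
    ((1 + PowerSeries.X : PowerSeries 𝒪) • Φ) 0 = Φ 1 := by
  rw [add_smul, one_smul, BigRepModule.add_apply, X_smul_apply_zero, add_sub_cancel]

/-- **ORIENTATION LEMMA (cocycle level).** For a 1-cocycle `c` of `bigRep κ ρ`, `γ̃ ∈ G` with
`κ γ̃ = 1 ∈ ℤ_p` and `h ∈ ker κ`: `ρ(γ̃)(c(γ̃⁻¹ h γ̃)(0)) = c(h)(1) + (ρ(h)(c(γ̃)(1)) − c(γ̃)(1))` — the
conjugate `conj_γ̃` of the Shapiro image `h ↦ c(h)(0)` is the Shapiro image of `(1+T)·c` up to the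
coboundary of `b = c(γ̃)(1)`. Proof: the cocycle identity `c(γ̃) + γ̃·c(γ̃⁻¹hγ̃) = c(hγ̃) = c(h) + h·c(γ̃)`
evaluated at `x = κ γ̃ = 1`, where `(γ̃·Ψ)(1) = ρ(γ̃)Ψ(0)` and `(h·Ψ)(1) = ρ(h)Ψ(1)`.
[cite: SkinnerUrban2014, §3.2.2 and Prop. 3.2.3 (the `Λ_{F,A}`-module structures, `ε_F⁻¹`)]
[cite: GreenbergLNM1716, §1 (the action of `Γ` on `H¹(K_∞, ·)` by inner automorphisms)] -/
theorem conj_apply_zero_eq {c : G → BigRepModule 𝒪 p A}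
    (hc : ∀ g h : G, c (g * h) = c g + bigRep κ ρ g (c h)) {γt : G} (hγ : κ γt = ofAdd 1)
    {h : G} (hh : κ h = 1) :
    ρ γt (c (γt⁻¹ * h * γt) 0) = c h 1 + (ρ h (c γt 1) - c γt 1) := by
  -- the two expansions of `c (h * γt) = c (γt * (γt⁻¹ * h * γt))`, read at `x = 1`
  have h1 : c (h * γt) = c h + bigRep κ ρ h (c γt) := hc h γt
  have h2 : c (h * γt) = c γt + bigRep κ ρ γt (c (γt⁻¹ * h * γt)) := by
    have e : γt * (γt⁻¹ * h * γt) = h * γt := by group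
    rw [← e]
    exact hc γt (γt⁻¹ * h * γt)
  have key := congrArg (fun Ψ : BigRepModule 𝒪 p A ↦ Ψ 1) (h1.symm.trans h2)
  simp only [BigRepModule.add_apply, bigRep_apply_apply, hh, hγ, toAdd_one, toAdd_ofAdd, sub_zero,
    sub_self] at key
  -- `key : c h 1 + ρ h (c γt 1) = c γt 1 + ρ γt (c (γt⁻¹ * h * γt) 0)`
  rw [← add_sub_assoc, key, add_sub_cancel_left]

/-- The orientation lemma with the `Λ`-action spelled out: for `κ γ̃ = 1`, `h ∈ ker κ`,
`ρ(γ̃)(c(γ̃⁻¹ h γ̃)(0)) = ((1+T)·c(h))(0) + (ρ(h) b − b)`, `b = c(γ̃)(1)` — "`Sh[(1+T)·c] = conj_γ̃ (Sh[c])`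
in `H¹(ker κ, A)`". [cite: SkinnerUrban2014, §3.2.2 and Prop. 3.2.3] [cite: Castella2018, §2.2 ("`1 + T ↦ γ`")] -/
theorem conj_apply_zero_eq_one_add_X_smul {c : G → BigRepModule 𝒪 p A}
    (hc : ∀ g h : G, c (g * h) = c g + bigRep κ ρ g (c h)) {γt : G} (hγ : κ γt = ofAdd 1)
    {h : G} (hh : κ h = 1) :
    ρ γt (c (γt⁻¹ * h * γt) 0) =
      ((1 + PowerSeries.X : PowerSeries 𝒪) • c h) 0 + (ρ h (c γt 1) - c γt 1) := by
  rw [one_add_X_smul_apply_zero, conj_apply_zero_eq hc hγ hh]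

end Literature.NumberTheory.EllipticCurves.BigRepModule

end
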